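import Summits.NavierStokesRegularity.FunctionalMining.TopEigGapCoerciveSimpleAux
import Summits.NavierStokesRegularity.FunctionalMining.TopEigHeatCoerciveGap
import HarnessLib

/-!
# FunctionalMining — Proposition L-λ(η) at `q = 2` IN THE KERNEL on the everywhere-simple part of the
# top-gap class: `(2π²η²/27) · Φ₂(v) ≤ T₂(v)` whenever `λ₂ ≤ (1−η)λ₁` and `λ₂ < λ₁` everywhere

Search for candidate a priori estimates; no regularity claim. Cell `pub-nsfunc`, prove seat
(gen 25). Step (iii) of the kernel plan for the dictionary's node `TopEigGapCoerciveTwo η` /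
`TopEigGapCoercivePos 2 η` (`TopEigHeatCoerciveGap.lean`; Proposition L-λ(η) of the no-go seat,
SIEVELD §3.4b (4), proved on paper): the assembly, for fields whose top strain eigenvalue is simple
at EVERY point (on the gap class this excludes exactly the fields whose strain vanishes somewhere —
step (iv), the zeros of `S`, is NOT treated here). With `M := λ₁ · (u₀ ⊗ u₀) = λ₁ · topProj v`:

* `four_pi_sq_mul_integral_sq_sub_mean_le` — the scalar Poincaré inequality on `T³`,
  `4π² ∫ (f − ∫f)² ≤ ∫ ∑ₖ (∂ₖf)²` for smooth `f` (from the tree's vector-field form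
  `Torus.integral_norm_sq_le_gradNormSq_of_hasZeroMean` applied to `f · e₀`);
* `isSmooth_topProj_entry`, `isSmooth_lamProj_entry` — on everywhere-simple fields the entries of
  `topProj` and of `M` are `C^∞` (chart lemma `exists_smooth_topProjector_chart_of_gapForm`);
* pointwise identities: `sum_strain_mul_lamProj` (`∑ᵢⱼ Sᵢⱼ Mᵢⱼ = λ₁²`), `integral_strainEntry_eq_zero`
  (`∫ Sᵢⱼ = 0`), `sum_sq_strainEntry_le` (`∑ᵢⱼ Sᵢⱼ² ≤ 36 λ₁²`, from `|S| ≤ 6λ₁`);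
* **`topEigMoment_two_le_heatDissipation_of_gap_simple`** — for `v` smooth and divergence free on
  `T³`, `0 < η ≤ 1`, `λ₂ ≤ (1−η)λ₁` and `λ₂ < λ₁` at every point:
  `(2π²η²/27) · Φ₂(v) ≤ heatDissipation Φ₂ v`.
  Proof: `Φ₂ = ∫λ₁² = ∫ S:(M − M̄)` (`∫S = 0`) `≤ 6 Φ₂^{1/2} ‖M − M̄‖₂`, so `Φ₂ ≤ 36‖M − M̄‖₂²
  ≤ (36/4π²) ∑ₖ‖∂ₖM‖₂² ≤ (9/π²)(2/η²) ∫∑ₖ|S(∂ₖv)u₀|² ≤ (9/π²)(2/η²)(3/4) T₂`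
  (`TopEigGapFieldDeriv`, `TopEigColumnCharge`);
* `topEigHeatCoerciveOnGap_two_simple` — the same as
  `HeatCoerciveOn (fun v => StrainGapClass η v ∧ ∀ x, λ₂ x < λ₁ x) (torusTopEigMoment 2) (2π²η²/27)`.

The constant is weaker than the pen's `4π²η/(6(1+√3)²)` (the pen bounds `div M`, here `∇M`).
NOT CLAIMED: the node itself (fields of the class with zeros of `S` are not covered). [ours]
-/
noncomputable section

open Filter Topology Matrix Finset MeasureTheory
open scoped ContDiff

namespace Summit.NavierStokesRegularity.FunctionalMining

open Literature.Analysis Literature.Analysis.FunctionSpaces Literature.Analysis.FunctionSpaces.Torus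
  SharpClass.DirectorForm Literature.Analysis.Matrix

namespace TopEig

variable {v : UnitAddTorus (Fin 3) → EuclideanSpace ℝ (Fin 3)}
/-! ## 4. Assembly: L-λ(η) at `q = 2` on everywhere-simple fields of the top-gap class -/

/-- Commuting a triple finite sum. [folklore] -/
theorem sum_three_comm (a : Fin 3 → Fin 3 → Fin 3 → ℝ) :
    ∑ k, ∑ i, ∑ j, a k i j = ∑ i, ∑ j, ∑ k, a k i j := by
  rw [Finset.sum_comm]
  exact Finset.sum_congr rfl fun i _ => Finset.sum_comm

/-- **PROPOSITION L-λ(η) AT `q = 2`, EVERYWHERE-SIMPLE CASE, KERNEL FORM.** For `v` smooth and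
divergence free on `T³`, `0 < η ≤ 1`, with `λ₂(x) ≤ (1 − η)λ₁(x)` and `λ₂(x) < λ₁(x)` at every `x`:
`(2π²η²/27) · Φ₂(v) ≤ heatDissipation Φ₂ v = T₂(v)`. [ours; the no-go seat's Proposition L-λ(η)
(SIEVELD §3.4b (4)) on the everywhere-simple part of the class, with a weaker constant] -/
theorem topEigMoment_two_le_heatDissipation_of_gap_simple (hv : Torus.IsSmooth v)
    (hdiv : Torus.IsDivFree v) {η : ℝ} (hη0 : 0 < η) (hη1 : η ≤ 1)
    (hgap : ∀ x : UnitAddTorus (Fin 3), torusStrainMidEig v x ≤ (1 - η) * torusStrainTopEig v x)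
    (hsimple : ∀ x : UnitAddTorus (Fin 3), torusStrainMidEig v x < torusStrainTopEig v x) :
    2 * Real.pi ^ 2 * η ^ 2 / 27 * torusTopEigMoment 2 v ≤ heatDissipation (torusTopEigMoment 2) v := by
  have hMs : ∀ i j, Torus.IsSmooth (fun y => torusStrainTopEig v y * topProj v y i j) :=
    fun i j => isSmooth_lamProj_entry hv hsimple i j
  -- gap form everywhere, smooth positive `λ₁`
  have hgf : ∀ x : UnitAddTorus (Fin 3), ∃ (e : Fin 3 → ℝ) (lam g : ℝ), e ⬝ᵥ e = 1 ∧
      torusStrainMatrix v x *ᵥ e = lam • e ∧ 0 < g ∧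
      ∀ w, w ⬝ᵥ e = 0 → w ⬝ᵥ torusStrainMatrix v x *ᵥ w ≤ (lam - g) * (w ⬝ᵥ w) := fun x => by
    obtain ⟨e, he1, hSe, hg, hgap'⟩ := exists_gapForm_of_midEig_lt_topEig (hsimple x)
    exact ⟨e, _, _, he1, hSe, hg, hgap'⟩
  have hls : Torus.IsSmooth (torusStrainTopEig v) := isSmooth_torusStrainTopEig_of_simple hv hgf
  have hpos : ∀ x, 0 < torusStrainTopEig v x := fun x => by
    obtain ⟨e, lam, g, he1, hSe, hg, hgap'⟩ := hgf x
    rw [torusStrainTopEig_eq_of_gapForm he1 hSe hg hgap']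
    exact (lam_pos_of_gapForm_of_isDivFree hv hdiv he1 hSe hg hgap').2
  -- (1) `Φ₂ = ∫ λ₁²`
  have hΦ : torusTopEigMoment 2 v = ∫ x, torusStrainTopEig v x ^ 2 := by
    rw [torusTopEigMoment_eq hv hdiv 2]
    refine integral_congr_ae (ae_of_all _ fun x => ?_)
    show lam (StrainL4.strainFlat v x) ^ (2 : ℝ) = torusStrainTopEig v x ^ 2
    rw [lam_strainFlat, Real.rpow_two]
  have hF0 : 0 ≤ torusTopEigMoment 2 v := by rw [hΦ]; exact integral_nonneg fun x => sq_nonneg _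
  -- (2) channel density `ρ`: `T = ∫ρ`, `ρ` integrable, and the gradient of `M` bounded by `(3/(2η²)) ρ`
  have h12 : (1 : ℝ) ≤ 2 := by norm_num
  obtain ⟨hTρ, -, -⟩ := heatDissipation_topEigMoment_eq_integral_of_midEig_lt h12 hv hdiv hsimple
  have hρint : Integrable (fun x => 2 * (2 - 1) * torusStrainTopEig v x ^ ((2 : ℝ) - 2) *
        ∑ k, Torus.partialDeriv k (torusStrainTopEig v) x ^ 2 +
      2 * torusStrainTopEig v x ^ ((2 : ℝ) - 1) * (Torus.laplacian (torusStrainTopEig v) x -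
        dirTopEig (StrainL4.strainFlat v x) (StrainL4.strainFlat (Torus.laplacian v) x))) volume := by
    have hlq : Torus.IsSmooth (fun y => torusStrainTopEig v y ^ (2 : ℝ)) := isSmooth_rpow_of_pos hls hpos 2
    have hD := integrable_danskinDensity h12 hv hv.laplacian hdiv
    have hL := hlq.laplacian.integrable
    refine (hL.sub hD).congr (ae_of_all _ fun x => ?_)
    simp only [Pi.sub_apply]
    rw [laplacian_rpow_of_pos hls hpos 2 x]
    ring
  have hGle : ∀ x, ∑ k, ∑ i, ∑ j,
      (Torus.partialDeriv k (fun y => torusStrainTopEig v y * topProj v y i j) x) ^ 2 ≤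
      3 / (2 * η ^ 2) * (2 * (2 - 1) * torusStrainTopEig v x ^ ((2 : ℝ) - 2) *
        ∑ k, Torus.partialDeriv k (torusStrainTopEig v) x ^ 2 +
      2 * torusStrainTopEig v x ^ ((2 : ℝ) - 1) * (Torus.laplacian (torusStrainTopEig v) x -
        dirTopEig (StrainL4.strainFlat v x) (StrainL4.strainFlat (Torus.laplacian v) x))) := by
    intro x
    have ha₀ := eigenvalues_topIndex v x
    have h1 : ∑ k, ∑ i, ∑ j,
        (Torus.partialDeriv k (fun y => torusStrainTopEig v y * topProj v y i j) x) ^ 2 ≤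
        2 / η ^ 2 * topColumnSq v x := by
      unfold topColumnSq
      rw [Finset.mul_sum]
      exact Finset.sum_le_sum fun k _ =>
        sum_sq_partialDeriv_lamProj_le_of_gap hv hdiv hη0 hη1 (hsimple x) (hgap x) ha₀ k
    have h2 : 2 * 2 / 3 * torusStrainTopEig v x ^ ((2 : ℝ) - 2) * topColumnSq v x ≤
        2 * (2 - 1) * torusStrainTopEig v x ^ ((2 : ℝ) - 2) *
          ∑ k, Torus.partialDeriv k (torusStrainTopEig v) x ^ 2 +
        2 * torusStrainTopEig v x ^ ((2 : ℝ) - 1) * (Torus.laplacian (torusStrainTopEig v) x -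
          dirTopEig (StrainL4.strainFlat v x) (StrainL4.strainFlat (Torus.laplacian v) x)) :=
      channelIntegrand_ge_column_sq (q := 2) (by norm_num) hv hdiv (hsimple x) ha₀
    have e0 : torusStrainTopEig v x ^ ((2 : ℝ) - 2) = 1 := by
      rw [show (2 : ℝ) - 2 = 0 by norm_num, Real.rpow_zero]
    rw [e0, mul_one] at h2
    have hη2 : 0 < η ^ 2 := pow_pos hη0 2
    have hc : 0 ≤ 2 / η ^ 2 := by positivity
    have h3 : 2 / η ^ 2 * topColumnSq v x ≤ 2 / η ^ 2 * (3 / 4 * (2 * (2 - 1) * 1 *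
          ∑ k, Torus.partialDeriv k (torusStrainTopEig v) x ^ 2 +
        2 * torusStrainTopEig v x ^ ((2 : ℝ) - 1) * (Torus.laplacian (torusStrainTopEig v) x -
          dirTopEig (StrainL4.strainFlat v x) (StrainL4.strainFlat (Torus.laplacian v) x)))) :=
      mul_le_mul_of_nonneg_left (by linarith) hc
    refine h1.trans (h3.trans (le_of_eq ?_))
    rw [e0]
    field_simp
    ring
  have hG0 : ∀ x, 0 ≤ ∑ k, ∑ i, ∑ j,
      (Torus.partialDeriv k (fun y => torusStrainTopEig v y * topProj v y i j) x) ^ 2 := fun x =>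
    Finset.sum_nonneg fun k _ => Finset.sum_nonneg fun i _ => Finset.sum_nonneg fun j _ => sq_nonneg _
  have hGint_le : ∫ x, ∑ k, ∑ i, ∑ j,
      (Torus.partialDeriv k (fun y => torusStrainTopEig v y * topProj v y i j) x) ^ 2 ≤
      3 / (2 * η ^ 2) * heatDissipation (torusTopEigMoment 2) v := by
    rw [hTρ, ← integral_const_mul]
    exact integral_mono_of_nonneg (ae_of_all _ hG0) (hρint.const_mul _) (ae_of_all _ hGle)
  -- (3) Poincaré entrywise and the sum over entries
  have hIk : ∀ i j k, Integrable (fun x =>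
      (Torus.partialDeriv k (fun y => torusStrainTopEig v y * topProj v y i j) x) ^ 2) volume :=
    fun i j k => ((((hMs i j).partialDeriv k).continuous).pow 2).integrable_unitAddTorus
  have hEij : ∀ i j, Integrable (fun x => (torusStrainTopEig v x * topProj v x i j -
      ∫ y, torusStrainTopEig v y * topProj v y i j) ^ 2) volume := fun i j =>
    (((hMs i j).continuous.sub continuous_const).pow 2).integrable_unitAddTorus
  have hP : ∀ i j, 4 * Real.pi ^ 2 * ∫ x, (torusStrainTopEig v x * topProj v x i j -
      ∫ y, torusStrainTopEig v y * topProj v y i j) ^ 2 ≤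
      ∫ x, ∑ k, (Torus.partialDeriv k (fun y => torusStrainTopEig v y * topProj v y i j) x) ^ 2 :=
    fun i j => four_pi_sq_mul_integral_sq_sub_mean_le (hMs i j)
  set D : ℝ := ∑ i, ∑ j, ∫ x, (torusStrainTopEig v x * topProj v x i j -
      ∫ y, torusStrainTopEig v y * topProj v y i j) ^ 2 with hDdef
  have hD0 : 0 ≤ D := Finset.sum_nonneg fun i _ => Finset.sum_nonneg fun j _ =>
    integral_nonneg fun x => sq_nonneg _
  have hGsum : ∫ x, ∑ k, ∑ i, ∑ j,
      (Torus.partialDeriv k (fun y => torusStrainTopEig v y * topProj v y i j) x) ^ 2 =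
      ∑ i, ∑ j, ∫ x, ∑ k, (Torus.partialDeriv k (fun y => torusStrainTopEig v y * topProj v y i j) x) ^ 2 := by
    have e1 : ∀ x, ∑ k, ∑ i, ∑ j,
        (Torus.partialDeriv k (fun y => torusStrainTopEig v y * topProj v y i j) x) ^ 2 =
        ∑ i, ∑ j, ∑ k, (Torus.partialDeriv k (fun y => torusStrainTopEig v y * topProj v y i j) x) ^ 2 :=
      fun x => sum_three_comm (fun k i j =>
        (Torus.partialDeriv k (fun y => torusStrainTopEig v y * topProj v y i j) x) ^ 2)
    simp_rw [e1]
    have hIij : ∀ i j, Integrable (fun x => ∑ k,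
        (Torus.partialDeriv k (fun y => torusStrainTopEig v y * topProj v y i j) x) ^ 2) volume :=
      fun i j => integrable_finsetSum _ fun k _ => hIk i j k
    rw [integral_finsetSum _ fun i _ => integrable_finsetSum _ fun j _ => hIij i j]
    exact Finset.sum_congr rfl fun i _ => integral_finsetSum _ fun j _ => hIij i j
  have hPD : 4 * Real.pi ^ 2 * D ≤ 3 / (2 * η ^ 2) * heatDissipation (torusTopEigMoment 2) v := by
    refine le_trans ?_ hGint_le
    rw [hGsum, hDdef, Finset.mul_sum]
    refine Finset.sum_le_sum fun i _ => ?_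
    rw [Finset.mul_sum]
    exact Finset.sum_le_sum fun j _ => hP i j
  -- (4) `Φ₂ = ∫ S:(M − m) ≤ 6 √Φ₂ √D′`, `D′ = ∫ ∑ᵢⱼ (Mᵢⱼ − mᵢⱼ)² = D`
  have hSM : ∀ x, torusStrainTopEig v x ^ 2 =
      ∑ i, ∑ j, torusStrainMatrix v x i j * (torusStrainTopEig v x * topProj v x i j -
        ∫ y, torusStrainTopEig v y * topProj v y i j) +
        ∑ i, ∑ j, torusStrainMatrix v x i j * ∫ y, torusStrainTopEig v y * topProj v y i j := by
    intro x
    rw [← sum_strain_mul_lamProj v x, ← Finset.sum_add_distrib]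
    refine Finset.sum_congr rfl fun i _ => ?_
    rw [← Finset.sum_add_distrib]
    exact Finset.sum_congr rfl fun j _ => by ring
  have hSint : ∀ i j, Integrable (fun x => torusStrainMatrix v x i j) volume :=
    fun i j => (isSmooth_torusStrainMatrix_entry hv i j).integrable
  have hmean0 : ∫ x, ∑ i, ∑ j, torusStrainMatrix v x i j *
      ∫ y, torusStrainTopEig v y * topProj v y i j = 0 := by
    rw [integral_finsetSum _ fun i _ => integrable_finsetSum _ fun j _ => (hSint i j).mul_const _]
    refine Finset.sum_eq_zero fun i _ => ?_
    rw [integral_finsetSum _ fun j _ => (hSint i j).mul_const _]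
    refine Finset.sum_eq_zero fun j _ => ?_
    rw [integral_mul_const, integral_strainEntry_eq_zero hv i j, zero_mul]
  -- `Q(x) := √(∑ᵢⱼ (Mᵢⱼ − mᵢⱼ)²)`
  have hQcont : Continuous fun x => Real.sqrt (∑ i, ∑ j, (torusStrainTopEig v x * topProj v x i j -
      ∫ y, torusStrainTopEig v y * topProj v y i j) ^ 2) :=
    (continuous_finsetSum _ fun i _ => continuous_finsetSum _ fun j _ =>
      ((hMs i j).continuous.sub continuous_const).pow 2).sqrt
  have hCS : ∀ x, ∑ i, ∑ j, torusStrainMatrix v x i j * (torusStrainTopEig v x * topProj v x i j -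
        ∫ y, torusStrainTopEig v y * topProj v y i j) ≤
      6 * torusStrainTopEig v x * Real.sqrt (∑ i, ∑ j, (torusStrainTopEig v x * topProj v x i j -
        ∫ y, torusStrainTopEig v y * topProj v y i j) ^ 2) := by
    intro x
    have h1 := Finset.sum_mul_sq_le_sq_mul_sq (Finset.univ : Finset (Fin 3 × Fin 3))
      (fun p => torusStrainMatrix v x p.1 p.2)
      (fun p => torusStrainTopEig v x * topProj v x p.1 p.2 - ∫ y, torusStrainTopEig v y * topProj v y p.1 p.2)
    simp only [Fintype.sum_prod_type] at h1
    have h2 := h1.trans (mul_le_mul_of_nonneg_right (sum_sq_strainEntry_le hv hdiv x)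
      (Finset.sum_nonneg fun i _ => Finset.sum_nonneg fun j _ => sq_nonneg _))
    have h3 := Real.abs_le_sqrt h2
    rw [Real.sqrt_mul (by positivity), show (36 : ℝ) * torusStrainTopEig v x ^ 2 =
      (6 * torusStrainTopEig v x) ^ 2 by ring, Real.sqrt_sq (by linarith [(hpos x).le])] at h3
    exact (le_abs_self _).trans h3
  have hI1 : Integrable (fun x => ∑ i, ∑ j, torusStrainMatrix v x i j *
      (torusStrainTopEig v x * topProj v x i j - ∫ y, torusStrainTopEig v y * topProj v y i j)) volume :=
    (continuous_finsetSum _ fun i _ => continuous_finsetSum _ fun j _ =>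
      (isSmooth_torusStrainMatrix_entry hv i j).continuous.mul
        ((hMs i j).continuous.sub continuous_const)).integrable_unitAddTorus
  have hI2 : Integrable (fun x => ∑ i, ∑ j, torusStrainMatrix v x i j *
      ∫ y, torusStrainTopEig v y * topProj v y i j) volume :=
    (continuous_finsetSum _ fun i _ => continuous_finsetSum _ fun j _ =>
      (isSmooth_torusStrainMatrix_entry hv i j).continuous.mul continuous_const).integrable_unitAddTorus
  have hstep : torusTopEigMoment 2 v = ∫ x, ∑ i, ∑ j, torusStrainMatrix v x i j *
      (torusStrainTopEig v x * topProj v x i j - ∫ y, torusStrainTopEig v y * topProj v y i j) := by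
    rw [hΦ, integral_congr_ae (ae_of_all _ hSM), integral_add hI1 hI2, hmean0, add_zero]
  have hD' : ∫ x, ∑ i, ∑ j, (torusStrainTopEig v x * topProj v x i j -
      ∫ y, torusStrainTopEig v y * topProj v y i j) ^ 2 = D := by
    rw [hDdef, integral_finsetSum _ fun i _ => integrable_finsetSum _ fun j _ => hEij i j]
    exact Finset.sum_congr rfl fun i _ => integral_finsetSum _ fun j _ => hEij i j
  have hFle : torusTopEigMoment 2 v ≤ 6 * (Real.sqrt (torusTopEigMoment 2 v) * Real.sqrt D) := by
    have hf : MemLp (fun x => torusStrainTopEig v x) (ENNReal.ofReal 2) volume :=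
      hls.continuous.memLp_of_hasCompactSupport (HasCompactSupport.of_compactSpace _)
    have hg : MemLp (fun x => Real.sqrt (∑ i, ∑ j, (torusStrainTopEig v x * topProj v x i j -
        ∫ y, torusStrainTopEig v y * topProj v y i j) ^ 2)) (ENNReal.ofReal 2) volume :=
      hQcont.memLp_of_hasCompactSupport (HasCompactSupport.of_compactSpace _)
    have hH := integral_mul_le_Lp_mul_Lq_of_nonneg (μ := volume) Real.HolderConjugate.two_two
      (ae_of_all _ fun x => (hpos x).le) (ae_of_all _ fun x => Real.sqrt_nonneg _) hf hg
    have e1 : ∫ x, torusStrainTopEig v x ^ (2 : ℝ) = torusTopEigMoment 2 v := by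
      rw [hΦ]; exact integral_congr_ae (ae_of_all _ fun x => Real.rpow_two _)
    have e2 : ∫ x, Real.sqrt (∑ i, ∑ j, (torusStrainTopEig v x * topProj v x i j -
        ∫ y, torusStrainTopEig v y * topProj v y i j) ^ 2) ^ (2 : ℝ) = D := by
      rw [← hD']
      refine integral_congr_ae (ae_of_all _ fun x => ?_)
      dsimp only
      rw [Real.rpow_two, Real.sq_sqrt (Finset.sum_nonneg fun i _ => Finset.sum_nonneg fun j _ => sq_nonneg _)]
    rw [e1, e2, ← Real.sqrt_eq_rpow, ← Real.sqrt_eq_rpow] at hH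
    calc torusTopEigMoment 2 v = _ := hstep
      _ ≤ ∫ x, 6 * torusStrainTopEig v x * Real.sqrt (∑ i, ∑ j, (torusStrainTopEig v x * topProj v x i j -
            ∫ y, torusStrainTopEig v y * topProj v y i j) ^ 2) :=
          integral_mono hI1 ((continuous_const.mul hls.continuous).mul hQcont).integrable_unitAddTorus hCS
      _ = 6 * ∫ x, torusStrainTopEig v x * Real.sqrt (∑ i, ∑ j, (torusStrainTopEig v x * topProj v x i j -
            ∫ y, torusStrainTopEig v y * topProj v y i j) ^ 2) := by
          rw [← integral_const_mul]
          exact integral_congr_ae (ae_of_all _ fun x => by ring)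
      _ ≤ 6 * (Real.sqrt (torusTopEigMoment 2 v) * Real.sqrt D) := by linarith
  -- (5) `Φ₂ ≤ 36 D`
  have hF36 : torusTopEigMoment 2 v ≤ 36 * D := by
    have hsF0 : 0 ≤ Real.sqrt (torusTopEigMoment 2 v) := Real.sqrt_nonneg _
    have hsD0 : 0 ≤ Real.sqrt D := Real.sqrt_nonneg D
    have hFsq : torusTopEigMoment 2 v = Real.sqrt (torusTopEigMoment 2 v) ^ 2 := (Real.sq_sqrt hF0).symm
    have hDsq : D = Real.sqrt D ^ 2 := (Real.sq_sqrt hD0).symm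
    rcases hsF0.eq_or_lt with hs | hs
    · rw [hFsq, ← hs]; nlinarith [hD0]
    · have h1 : Real.sqrt (torusTopEigMoment 2 v) * Real.sqrt (torusTopEigMoment 2 v) ≤
          Real.sqrt (torusTopEigMoment 2 v) * (6 * Real.sqrt D) := by
        have := hFle; rw [hFsq] at this; nlinarith
      have h2 : Real.sqrt (torusTopEigMoment 2 v) ≤ 6 * Real.sqrt D := le_of_mul_le_mul_left h1 hs
      rw [hFsq, hDsq]; nlinarith
  -- (6) assembly
  have hπ : 0 < 4 * Real.pi ^ 2 := by positivity
  have hη2 : 0 < η ^ 2 := pow_pos hη0 2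
  have hDle : D ≤ (4 * Real.pi ^ 2)⁻¹ * (3 / (2 * η ^ 2) * heatDissipation (torusTopEigMoment 2) v) := by
    rw [le_inv_mul_iff₀ hπ]
    exact hPD
  have hfinal : torusTopEigMoment 2 v ≤
      36 * ((4 * Real.pi ^ 2)⁻¹ * (3 / (2 * η ^ 2) * heatDissipation (torusTopEigMoment 2) v)) :=
    hF36.trans (mul_le_mul_of_nonneg_left hDle (by norm_num))
  have e : 36 * ((4 * Real.pi ^ 2)⁻¹ * (3 / (2 * η ^ 2) * heatDissipation (torusTopEigMoment 2) v)) =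
      27 / (2 * Real.pi ^ 2 * η ^ 2) * heatDissipation (torusTopEigMoment 2) v := by
    field_simp; ring
  rw [e] at hfinal
  have hpi2 : 0 < Real.pi ^ 2 := by positivity
  calc 2 * Real.pi ^ 2 * η ^ 2 / 27 * torusTopEigMoment 2 v
      ≤ 2 * Real.pi ^ 2 * η ^ 2 / 27 * (27 / (2 * Real.pi ^ 2 * η ^ 2) * heatDissipation (torusTopEigMoment 2) v) :=
        mul_le_mul_of_nonneg_left hfinal (by positivity)
    _ = heatDissipation (torusTopEigMoment 2) v := by field_simp

/-- **The same in the dictionary's vocabulary:** heat coercivity of `Φ₂` at rate `2π²η²/27` ON THE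
SUB-CLASS of the top-gap class `λ₂ ≤ (1−η)λ₁` where `λ₁` is simple everywhere:
`HeatCoerciveOn (fun v => StrainGapClass η v ∧ ∀ x, λ₂(x) < λ₁(x)) Φ₂ (2π²η²/27)` (`0 < η ≤ 1`).
The node `TopEigGapCoerciveTwo η` / `TopEigGapCoercivePos 2 η` itself (whole class, incl. fields whose
strain vanishes somewhere) is NOT claimed. [ours] -/
theorem topEigHeatCoerciveOnGap_two_simple {η : ℝ} (hη0 : 0 < η) (hη1 : η ≤ 1) :
    HeatCoerciveOn (d := Fin 3)
      (fun v => StrainGapClass η v ∧ ∀ x : UnitAddTorus (Fin 3), torusStrainMidEig v x < torusStrainTopEig v x)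
      (torusTopEigMoment 2) (2 * Real.pi ^ 2 * η ^ 2 / 27) := by
  intro _ v hv hdiv _ hcls
  exact topEigMoment_two_le_heatDissipation_of_gap_simple hv hdiv hη0 hη1 hcls.1 hcls.2

end TopEig

end Summit.NavierStokesRegularity.FunctionalMining

end
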